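import Literature.NumberTheory.LFunctions.Zhang2022.DetectorMainTermFormCS

/-!
# Zhang (2022), programme F-S3 (cell landau-siegel, family B-det): the recipe form depends on the detector
# only through SIX channel moments — the «atoms» expansion of `M_R` for an arbitrary recipe

Y. Zhang, *Discrete mean estimates and the Landau–Siegel zero*, arXiv:2211.02515v1 [Zhang2022LandauSiegel] —
an unrefereed manuscript under adjudication. **WHAT THIS IS NOT: not a claim about Theorems 1–2 of
arXiv:2211.02515, about Landau–Siegel zeros, or about Parity; nothing here asserts any claim of the manuscript.**
«The programme SEARCHES and TYPES; no claim about Landau–Siegel zeros, Theorems 1–2 of arXiv:2211.02515 or a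
repaired Margin232 until a kernel theorem says so.»

Companion (theorems only) of `DetectorMainTermForm` (D-det-1). The tree's `Repair.Mform_eq_atoms` writes formula I
of the PRINTED detector on one-sided kinked profiles as `(1/π)[4A₁ − 15iπA₂ + 9iπA₄ + 44π²A₅ − 12π²g(0)Ī_h
+ 24iπ³(I_gĪ_h − A₇)]` in the seven profile atoms (`A₁ = ⟨g′,h′⟩`, `A₂ = ⟨g′,h⟩`, `A₄ = ⟨g,h′⟩`, `A₅ = ⟨g,h⟩`,
`A₇ = ⟨g,S_h⟩`, `I_g = ∫g`, `I_h = ∫h`), the numbers being the channel sums `ΣW_j = 4`, `ΣW_jS_j = 15`,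
`ΣW_jb_j = 9`, `ΣW_jN_j + ΣW_jb_jS_j = 12 + 32`, `ΣW_jN_j = 12`, `ΣW_jb_jN_j = 24`. Here the SAME bookkeeping is
done for an ARBITRARY three-channel recipe `R = (W_j, b_j, s_j, n_j)`:

* `integral_dipoleIntegrandDet_eq` — one channel integrated on one-sided kinked profiles (`g(1) = 0`): the tail
  `∫_y^1 h = I_h − S_h(y)`, `∫₀¹ g′ = −g(0)` and the integration by parts `∫ g′·conj S_h = −⟨g,h⟩`
  (verbatim the tree's `Repair.integral_dipoleIntegrand_eq` with symbolic `(b, s, n)`);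
* **`MformDet_eq_moments`** — `M_R(g,h) = (1/π)[m₀A₁ − iπm_sA₂ + iπm_bA₄ + π²(m_n + m_bs)A₅ − π²m_n g(0)Ī_h
  + iπ³m_bn(I_gĪ_h − A₇)]` with the six CHANNEL MOMENTS `m₀ = ΣW_j`, `m_s = ΣW_js_j`, `m_n = ΣW_jn_j`,
  `m_b = ΣW_jb_j`, `m_bs = ΣW_jb_js_j`, `m_bn = ΣW_jb_jn_j` (written as explicit `Fin 3` sums — no new
  definitions). READING for the B-det design space: on the one-sided class the main-term form `𝔅_R` of a detector,
  hence its definiteness (`Det.FormDetPSD R`, registry E-010) and every OBJ value, is a function of these six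
  complex numbers only — two recipes with equal moments have identical `M_R`
  (`MformDet_eq_of_moments_eq`); the printed moments are `(4, 15, 12, 9, 32, 24)` (`moments_zhang`).

Elementary; no definitions, no `Prop` facts.
-/

noncomputable section

open Complex Real ComplexConjugate Set intervalIntegral
open _root_.MeasureTheory

namespace Literature.NumberTheory.LFunctions.Zhang2022

namespace Det

open Repair

variable {R : DetRecipe} {g g' h h' : ℝ → ℂ}

/-- `conj` commutes with the interval integral. [cite: Zhang2022LandauSiegel, Prop 7.1 with (8.11)–(8.23), pp.44–50] -/
private theorem conj_intervalIntegral' (f : ℝ → ℂ) (a b : ℝ) :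
    conj (∫ x in a..b, f x) = ∫ x in a..b, conj (f x) := by
  simp only [intervalIntegral, map_sub, integral_conj]

/-- Linearity of `∫₀¹` over four weighted integrable terms. [cite: Zhang2022LandauSiegel, Prop 7.1 with (8.11)–(8.23), pp.44–50] -/
private theorem integral_lin4' {f1 f2 f3 f4 : ℝ → ℂ} (c1 c2 c3 c4 : ℂ)
    (h1 : IntervalIntegrable f1 volume 0 1) (h2 : IntervalIntegrable f2 volume 0 1)
    (h3 : IntervalIntegrable f3 volume 0 1) (h4 : IntervalIntegrable f4 volume 0 1) :
    ∫ x in (0:ℝ)..1, (c1 * f1 x + c2 * f2 x + c3 * f3 x + c4 * f4 x)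
      = c1 * (∫ x in (0:ℝ)..1, f1 x) + c2 * (∫ x in (0:ℝ)..1, f2 x)
        + c3 * (∫ x in (0:ℝ)..1, f3 x) + c4 * (∫ x in (0:ℝ)..1, f4 x) := by
  rw [intervalIntegral.integral_add ((h1.const_mul c1).add ((h2.const_mul c2))|>.add (h3.const_mul c3))
      (h4.const_mul c4),
    intervalIntegral.integral_add ((h1.const_mul c1).add (h2.const_mul c2)) (h3.const_mul c3),
    intervalIntegral.integral_add (h1.const_mul c1) (h2.const_mul c2),
    intervalIntegral.integral_const_mul, intervalIntegral.integral_const_mul,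
    intervalIntegral.integral_const_mul, intervalIntegral.integral_const_mul]

/-- **One channel of formula I, integrated, in the seven profile atoms** (one-sided kinked `g`, kinked `h`):
the tree's `Repair.integral_dipoleIntegrand_eq` with symbolic channel coefficients `(b, s, n)`.
[cite: Zhang2022LandauSiegel, Prop 7.1 with (8.11)–(8.23), pp.44–50] -/
theorem integral_dipoleIntegrandDet_eq (hg : KinkedProfile g g') (hh : KinkedProfile h h')
    (hg1 : g 1 = 0) (b s n : ℝ) :
    ∫ y in (0:ℝ)..1, dipoleIntegrandDet b s n g g' h h' y
      = (∫ x in (0:ℝ)..1, g' x * conj (h' x))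
        - I * π * (s : ℂ) * (∫ x in (0:ℝ)..1, g' x * conj (h x))
        + (π : ℂ) ^ 2 * (n : ℂ)
            * ((∫ x in (0:ℝ)..1, g x * conj (h x)) - g 0 * conj (∫ x in (0:ℝ)..1, h x))
        + I * π * (b : ℂ) * (∫ x in (0:ℝ)..1, g x * conj (h' x))
        + (π : ℂ) ^ 2 * (b : ℂ) * (s : ℂ) * (∫ x in (0:ℝ)..1, g x * conj (h x))
        + I * (π : ℂ) ^ 3 * (b : ℂ) * (n : ℂ)
            * ((∫ x in (0:ℝ)..1, g x) * conj (∫ x in (0:ℝ)..1, h x)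
                - ∫ x in (0:ℝ)..1, g x * conj (∫ t in (0:ℝ)..x, h t)) := by
  have hgH := hg.isH1
  have hhH := hh.isH1
  -- integrability of the eight atoms
  have i1 : IntervalIntegrable (fun x => g' x * conj (h' x)) volume 0 1 :=
    IsH1OnUnitInterval.intervalIntegrable_deriv_mul_conj_deriv hgH hhH
  have i2 : IntervalIntegrable (fun x => g' x * conj (h x)) volume 0 1 :=
    IsH1OnUnitInterval.intervalIntegrable_deriv_mul_conj hgH hhH
  have i3 : IntervalIntegrable g' volume 0 1 := hgH.intervalIntegrable
  have hS : ContinuousOn (fun x => ∫ t in (0:ℝ)..x, h t) (Icc 0 1) := continuousOn_primitive_unit hh.cont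
  have i4 : IntervalIntegrable (fun x => g' x * conj (∫ t in (0:ℝ)..x, h t)) volume 0 1 :=
    i3.mul_continuousOn (by rw [uIcc_of_le zero_le_one]; exact continuousOn_conj_comp hS)
  have hch' : IntervalIntegrable (fun x => conj (h' x)) volume 0 1 := by
    rw [intervalIntegrable_iff, uIoc_of_le zero_le_one]
    exact hhH.memLp_conj.integrable one_le_two
  have i5 : IntervalIntegrable (fun x => g x * conj (h' x)) volume 0 1 :=
    hch'.continuousOn_mul (by rw [uIcc_of_le zero_le_one]; exact hg.cont)
  have i6 : IntervalIntegrable (fun x => g x * conj (h x)) volume 0 1 :=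
    IsH1OnUnitInterval.intervalIntegrable_mul_conj hgH hhH
  have i7 : IntervalIntegrable g volume 0 1 := hg.cont.intervalIntegrable_of_Icc zero_le_one
  have i8 : IntervalIntegrable (fun x => g x * conj (∫ t in (0:ℝ)..x, h t)) volume 0 1 :=
    IsH1OnUnitInterval.intervalIntegrable_mul_conj_primitive hgH hhH
  have ih : IntervalIntegrable h volume 0 1 := hh.cont.intervalIntegrable_of_Icc zero_le_one
  set Ih : ℂ := ∫ x in (0:ℝ)..1, h x with hIh
  -- pointwise expansion on [0,1]
  have hpt : EqOn (dipoleIntegrandDet b s n g g' h h')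
      (fun x => (1 * (g' x * conj (h' x)) + (-(I * π * (s : ℂ))) * (g' x * conj (h x))
          + ((π : ℂ) ^ 2 * (n : ℂ) * conj Ih) * g' x
          + (-((π : ℂ) ^ 2 * (n : ℂ))) * (g' x * conj (∫ t in (0:ℝ)..x, h t)))
        + ((I * π * (b : ℂ)) * (g x * conj (h' x))
          + ((π : ℂ) ^ 2 * (b : ℂ) * (s : ℂ)) * (g x * conj (h x))
          + (I * (π : ℂ) ^ 3 * (b : ℂ) * (n : ℂ) * conj Ih) * g x
          + (-(I * (π : ℂ) ^ 3 * (b : ℂ) * (n : ℂ))) * (g x * conj (∫ t in (0:ℝ)..x, h t))))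
      (uIcc 0 1) := by
    intro x hx
    rw [uIcc_of_le zero_le_one] at hx
    have htail : (∫ t in x..1, h t) = Ih - ∫ t in (0:ℝ)..x, h t := by
      rw [hIh, intervalIntegral.integral_interval_sub_left ih (intervalIntegrable_mono_unit ih hx)]
    unfold dipoleIntegrandDet
    rw [htail]
    simp only [map_add, map_sub, map_mul, map_pow, Complex.conj_I, Complex.conj_ofReal]
    linear_combination (-(π : ℂ) ^ 2 * (b : ℂ) * g x * (s : ℂ) * conj (h x)) * Complex.I_sq
  rw [intervalIntegral.integral_congr hpt,
    intervalIntegral.integral_add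
      ((((i1.const_mul _).add (i2.const_mul _)).add (i3.const_mul _)).add (i4.const_mul _))
      ((((i5.const_mul _).add (i6.const_mul _)).add (i7.const_mul _)).add (i8.const_mul _)),
    integral_lin4' _ _ _ _ i1 i2 i3 i4, integral_lin4' _ _ _ _ i5 i6 i7 i8,
    integral_deriv_eq_neg hg hg1, integral_deriv_mul_conj_primitive hg hg1 hh.cont]
  ring

/-- **`M_R` in the seven atoms and the six channel moments** (one-sided kinked `g`, kinked `h`):
`M_R(g,h) = (1/π)[m₀A₁ − iπm_sA₂ + iπm_bA₄ + π²(m_n + m_bs)A₅ − π²m_n g(0)Ī_h + iπ³m_bn(I_gĪ_h − A₇)]`,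
`m₀ = ΣW_j`, `m_s = ΣW_js_j`, `m_n = ΣW_jn_j`, `m_b = ΣW_jb_j`, `m_bs = ΣW_jb_js_j`, `m_bn = ΣW_jb_jn_j`
(printed: `4, 15, 12, 9, 32, 24`, `Repair.Mform_eq_atoms`). [cite: Zhang2022LandauSiegel, Prop 7.1 with (8.11)–(8.23), pp.44–50] -/
theorem MformDet_eq_moments (hg : KinkedProfile g g') (hh : KinkedProfile h h') (hg1 : g 1 = 0) :
    MformDet R g g' h h' = (((1 / π : ℝ)) : ℂ) *
      ((∑ j : Fin 3, R.W j) * (∫ x in (0:ℝ)..1, g' x * conj (h' x))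
        - I * π * (∑ j : Fin 3, R.W j * (R.s j : ℂ)) * (∫ x in (0:ℝ)..1, g' x * conj (h x))
        + I * π * (∑ j : Fin 3, R.W j * (R.b j : ℂ)) * (∫ x in (0:ℝ)..1, g x * conj (h' x))
        + (π : ℂ) ^ 2 * ((∑ j : Fin 3, R.W j * (R.n j : ℂ)) + ∑ j : Fin 3, R.W j * ((R.b j : ℂ) * (R.s j : ℂ)))
            * (∫ x in (0:ℝ)..1, g x * conj (h x))
        - (π : ℂ) ^ 2 * (∑ j : Fin 3, R.W j * (R.n j : ℂ)) * (g 0 * conj (∫ x in (0:ℝ)..1, h x))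
        + I * (π : ℂ) ^ 3 * (∑ j : Fin 3, R.W j * ((R.b j : ℂ) * (R.n j : ℂ)))
            * ((∫ x in (0:ℝ)..1, g x) * conj (∫ x in (0:ℝ)..1, h x)
                - ∫ x in (0:ℝ)..1, g x * conj (∫ t in (0:ℝ)..x, h t))) := by
  unfold MformDet
  simp only [Fin.sum_univ_three, integral_dipoleIntegrandDet_eq hg hh hg1]
  ring

/-- **Two recipes with the same six channel moments have the same formula I** on one-sided kinked profiles.
[cite: Zhang2022LandauSiegel, Prop 7.1 with (8.11)–(8.23), pp.44–50] -/
theorem MformDet_eq_of_moments_eq {R R' : DetRecipe}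
    (h0 : ∑ j : Fin 3, R.W j = ∑ j : Fin 3, R'.W j)
    (hs : ∑ j : Fin 3, R.W j * (R.s j : ℂ) = ∑ j : Fin 3, R'.W j * (R'.s j : ℂ))
    (hn : ∑ j : Fin 3, R.W j * (R.n j : ℂ) = ∑ j : Fin 3, R'.W j * (R'.n j : ℂ))
    (hb : ∑ j : Fin 3, R.W j * (R.b j : ℂ) = ∑ j : Fin 3, R'.W j * (R'.b j : ℂ))
    (hbs : ∑ j : Fin 3, R.W j * ((R.b j : ℂ) * (R.s j : ℂ)) = ∑ j : Fin 3, R'.W j * ((R'.b j : ℂ) * (R'.s j : ℂ)))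
    (hbn : ∑ j : Fin 3, R.W j * ((R.b j : ℂ) * (R.n j : ℂ)) = ∑ j : Fin 3, R'.W j * ((R'.b j : ℂ) * (R'.n j : ℂ)))
    (hg : KinkedProfile g g') (hh : KinkedProfile h h') (hg1 : g 1 = 0) :
    MformDet R g g' h h' = MformDet R' g g' h h' := by
  rw [MformDet_eq_moments hg hh hg1, MformDet_eq_moments hg hh hg1, h0, hs, hn, hb, hbs, hbn]

/-- Hence the same diagonal form `𝔅_R = 𝔅_{R'}` on the one-sided class (so `FormDetPSD R ↔ FormDetPSD R'`).
[cite: Zhang2022LandauSiegel, Prop 7.1 with (8.11)–(8.23), pp.44–50] -/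
theorem formDet_eq_of_moments_eq {R R' : DetRecipe}
    (h0 : ∑ j : Fin 3, R.W j = ∑ j : Fin 3, R'.W j)
    (hs : ∑ j : Fin 3, R.W j * (R.s j : ℂ) = ∑ j : Fin 3, R'.W j * (R'.s j : ℂ))
    (hn : ∑ j : Fin 3, R.W j * (R.n j : ℂ) = ∑ j : Fin 3, R'.W j * (R'.n j : ℂ))
    (hb : ∑ j : Fin 3, R.W j * (R.b j : ℂ) = ∑ j : Fin 3, R'.W j * (R'.b j : ℂ))
    (hbs : ∑ j : Fin 3, R.W j * ((R.b j : ℂ) * (R.s j : ℂ)) = ∑ j : Fin 3, R'.W j * ((R'.b j : ℂ) * (R'.s j : ℂ)))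
    (hbn : ∑ j : Fin 3, R.W j * ((R.b j : ℂ) * (R.n j : ℂ)) = ∑ j : Fin 3, R'.W j * ((R'.b j : ℂ) * (R'.n j : ℂ)))
    (hg : KinkedProfile g g') (hg1 : g 1 = 0) :
    FormDet R g g' = FormDet R' g g' := by
  rw [formDet_eq_two_mul_re, formDet_eq_two_mul_re, MformDet_eq_of_moments_eq h0 hs hn hb hbs hbn hg hg hg1]

/-- Transfer of positive semidefiniteness along equal moments. [cite: Zhang2022LandauSiegel, Prop 7.1 with (8.11)–(8.23), pp.44–50] -/
theorem formDetPSD_of_moments_eq {R R' : DetRecipe}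
    (h0 : ∑ j : Fin 3, R.W j = ∑ j : Fin 3, R'.W j)
    (hs : ∑ j : Fin 3, R.W j * (R.s j : ℂ) = ∑ j : Fin 3, R'.W j * (R'.s j : ℂ))
    (hn : ∑ j : Fin 3, R.W j * (R.n j : ℂ) = ∑ j : Fin 3, R'.W j * (R'.n j : ℂ))
    (hb : ∑ j : Fin 3, R.W j * (R.b j : ℂ) = ∑ j : Fin 3, R'.W j * (R'.b j : ℂ))
    (hbs : ∑ j : Fin 3, R.W j * ((R.b j : ℂ) * (R.s j : ℂ)) = ∑ j : Fin 3, R'.W j * ((R'.b j : ℂ) * (R'.s j : ℂ)))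
    (hbn : ∑ j : Fin 3, R.W j * ((R.b j : ℂ) * (R.n j : ℂ)) = ∑ j : Fin 3, R'.W j * ((R'.b j : ℂ) * (R'.n j : ℂ)))
    (hR : FormDetPSD R') : FormDetPSD R := fun g g' hg hg1 => by
  rw [formDet_eq_of_moments_eq h0 hs hn hb hbs hbn hg hg1]
  exact hR g g' hg hg1

/-- **The printed channel moments**: `(m₀, m_s, m_n, m_b, m_bs, m_bn) = (4, 15, 12, 9, 32, 24)` for `zhangRecipe`
(the numbers of `Repair.Mform_eq_atoms`: `44 = 12 + 32`). [cite: Zhang2022LandauSiegel, Prop 7.1 with (8.11)–(8.23), pp.44–50] -/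
theorem moments_zhang :
    (∑ j : Fin 3, zhangRecipe.W j) = 4
      ∧ (∑ j : Fin 3, zhangRecipe.W j * (zhangRecipe.s j : ℂ)) = 15
      ∧ (∑ j : Fin 3, zhangRecipe.W j * (zhangRecipe.n j : ℂ)) = 12
      ∧ (∑ j : Fin 3, zhangRecipe.W j * (zhangRecipe.b j : ℂ)) = 9
      ∧ (∑ j : Fin 3, zhangRecipe.W j * ((zhangRecipe.b j : ℂ) * (zhangRecipe.s j : ℂ))) = 32
      ∧ (∑ j : Fin 3, zhangRecipe.W j * ((zhangRecipe.b j : ℂ) * (zhangRecipe.n j : ℂ))) = 24 := by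
  simp only [zhangRecipe, Fin.sum_univ_three, Matrix.cons_val_zero, Matrix.cons_val_one, Matrix.cons_val_two,
    Matrix.head_cons, Matrix.tail_cons]
  push_cast
  norm_num

/-! ### The diagonal form in six moments («(4.1)_S», one-sided) -/

/-- **`𝔅_R(g)` in the six channel moments (one-sided kinked `g`, `g(1) = 0`):**
`𝔅_R(g) = (2/π)Re(m₀)‖g′‖² + 2Im(m_s⟨g′,g⟩) − 2Im(m_b⟨g,g′⟩) + 2πRe(m_n + m_bs)‖g‖² − 2πRe(m_n·g(0)·conj∫g)
− 2π²Im(m_bn(|∫g|² − ⟨g,S_g⟩))` (`⟨u,v⟩ = ∫₀¹u·conj v`, so `⟨g,g′⟩ = conj⟨g′,g⟩`; `S_g(x) = ∫₀ˣ g`) — the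
recipe analogue of the one-sided restriction of the manuscript's (4.1) (printed moments `(4,15,12,9,32,24)` give
`(8/π)‖g′‖² + 48Im⟨g′,g⟩ + 88π‖g‖² − 24πRe(g(0)Ī) − 48π²Im(|I|² − ⟨g,S_g⟩)`, i.e. `mainTermForm` at `g(1) = 0`;
identity asked for by the cell's lineage-B numerics, STATUS 2026-08-26T17:13:51Z).
[cite: Zhang2022LandauSiegel, Prop 7.1 with (8.11)–(8.23), pp.44–50] -/
theorem formDet_eq_moments (hg : KinkedProfile g g') (hg1 : g 1 = 0) :
    FormDet R g g'
      = 2 / π * (∑ j : Fin 3, R.W j).re * (∫ x in (0:ℝ)..1, ‖g' x‖ ^ 2)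
        + 2 * ((∑ j : Fin 3, R.W j * (R.s j : ℂ)) * ∫ x in (0:ℝ)..1, g' x * conj (g x)).im
        - 2 * ((∑ j : Fin 3, R.W j * (R.b j : ℂ)) * ∫ x in (0:ℝ)..1, g x * conj (g' x)).im
        + 2 * π * ((∑ j : Fin 3, R.W j * (R.n j : ℂ)) + ∑ j : Fin 3, R.W j * ((R.b j : ℂ) * (R.s j : ℂ))).re
            * (∫ x in (0:ℝ)..1, ‖g x‖ ^ 2)
        - 2 * π * ((∑ j : Fin 3, R.W j * (R.n j : ℂ)) * (g 0 * conj (∫ x in (0:ℝ)..1, g x))).re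
        - 2 * π ^ 2 * ((∑ j : Fin 3, R.W j * ((R.b j : ℂ) * (R.n j : ℂ)))
            * ((∫ x in (0:ℝ)..1, g x) * conj (∫ x in (0:ℝ)..1, g x)
                - ∫ x in (0:ℝ)..1, g x * conj (∫ t in (0:ℝ)..x, g t))).im := by
  rw [formDet_eq_two_mul_re, MformDet_eq_moments hg hg hg1, intervalIntegral_mul_conj_self g',
    intervalIntegral_mul_conj_self g]
  set m0 : ℂ := ∑ j : Fin 3, R.W j
  set ms : ℂ := ∑ j : Fin 3, R.W j * (R.s j : ℂ)
  set mn : ℂ := ∑ j : Fin 3, R.W j * (R.n j : ℂ)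
  set mb : ℂ := ∑ j : Fin 3, R.W j * (R.b j : ℂ)
  set mbs : ℂ := ∑ j : Fin 3, R.W j * ((R.b j : ℂ) * (R.s j : ℂ))
  set mbn : ℂ := ∑ j : Fin 3, R.W j * ((R.b j : ℂ) * (R.n j : ℂ))
  set A1 : ℝ := ∫ x in (0:ℝ)..1, ‖g' x‖ ^ 2
  set A2 : ℂ := ∫ x in (0:ℝ)..1, g' x * conj (g x)
  set A4 : ℂ := ∫ x in (0:ℝ)..1, g x * conj (g' x)
  set A5 : ℝ := ∫ x in (0:ℝ)..1, ‖g x‖ ^ 2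
  set B0 : ℂ := g 0 * conj (∫ x in (0:ℝ)..1, g x)
  set T7 : ℂ := (∫ x in (0:ℝ)..1, g x) * conj (∫ x in (0:ℝ)..1, g x)
    - ∫ x in (0:ℝ)..1, g x * conj (∫ t in (0:ℝ)..x, g t)
  have hπ : (π : ℝ) ≠ 0 := Real.pi_ne_zero
  simp only [Complex.mul_re, Complex.mul_im, Complex.add_re, Complex.add_im, Complex.sub_re, Complex.sub_im,
    Complex.ofReal_re, Complex.ofReal_im, Complex.I_re, Complex.I_im]
  simp only [← Complex.ofReal_pow, Complex.ofReal_re, Complex.ofReal_im]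
  field_simp
  ring

/-- For a SHIFT recipe the last moment factors: `b_j·n_j(b) = b₀b₁b₂` for every channel, so `m_bn = (Πb)·m₀`.
[cite: Zhang2022LandauSiegel, §8 (8.13)–(8.18)] -/
theorem shiftRecipe_b_mul_n (b : Fin 3 → ℝ) (j : Fin 3) : b j * shiftN b j = b 0 * b 1 * b 2 := by
  fin_cases j <;> simp [shiftN] <;> ring

/-- Hence `m_bn(shiftRecipe b) = (b₀b₁b₂)·ΣW_j(b)` (the `N·S₀` of the lineage-B closed form).
[cite: Zhang2022LandauSiegel, §8 (8.13)–(8.18); Prop 7.1 p.44] -/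
theorem shiftRecipe_moment_bn (b : Fin 3 → ℝ) :
    (∑ j : Fin 3, (shiftRecipe b).W j * (((shiftRecipe b).b j : ℂ) * ((shiftRecipe b).n j : ℂ)))
      = ((b 0 * b 1 * b 2 : ℝ) : ℂ) * ∑ j : Fin 3, (shiftRecipe b).W j := by
  have h : ∀ j : Fin 3, ((shiftRecipe b).b j : ℂ) * ((shiftRecipe b).n j : ℂ) = ((b 0 * b 1 * b 2 : ℝ) : ℂ) := by
    intro j
    have := shiftRecipe_b_mul_n b j
    simp only [shiftRecipe] at this ⊢
    exact_mod_cast this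
  simp only [h, Finset.mul_sum]
  refine Finset.sum_congr rfl fun j _ => ?_
  ring

end Det

end Literature.NumberTheory.LFunctions.Zhang2022
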